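import Summits.NavierStokesRegularity.NavierStokesRegularity.Theses.AmplitudeIndex
import Summits.NavierStokesRegularity.NavierStokesRegularity.Theses.MarginalTypeI
import HarnessLib.Audit

/-!
# Birth skeleton (BC3) of the shared crux `MarginalBlowupTypeI`
# (route AmplitudeIndex, crux M, rank 4; = route MarginalTypeI, crux C1, rank 2)

Crux item `stmt-NavierStokesRegularity-1748` (shared: `Theses.AmplitudeIndex.MarginalBlowupTypeI` and
`Theses.MarginalTypeI.MarginalBlowupTypeI` have byte-identical bodies); tree path
`Cruxes/MarginalBlowupTypeI/Lines/birth.lean`; registrar `planner-skel-stmt-NavierStokesRegularity-1748-0`,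
2026-08-17 (the routes predate the Lean birth certificate; this file supplies BC3 retroactively).
`ledger crux ls stmt-NavierStokesRegularity-1748`: no workfiles at registration — in particular no `Disproof.lean`
(Disproof used: none available; no `_false_without_` obstruction recorded, no landed `Negative/` lemma).

THE CRUX (M). For `ν > 0` and a Clay datum `u₀` at its CRITICAL VISCOSITY (`HasGlobalKatoSolution ν' u₀` for every
`ν' > ν`, `¬ HasGlobalKatoSolution ν u₀`), every Kato solution `u` on `[0, T)` at viscosity `ν` satisfies, at every
`x₀`, the local scaled-`L³` Type-I bound: `∃ r₀ > 0`, `⨆ {cknC r z u : r > 0, Q_r(z) ⊆ Q_{r₀}(T, x₀)} < ⊤`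
(`cknC r z u = r⁻² ∫∫_{Q_r(z)} |u|³`, backward parabolic cylinders `Q_r(t,x) = (t − r², t) × B_r(x)`).

THE CUT — "the marginal blow-up is the limit of GLOBAL solutions" made literal (it is the layer-2 split foreseen by
route MarginalTypeI's own TWO-LAYER PLAN: "C1 ⇐ family form (uniform bound along ν' ↓ ν_c) → C1 by continuous
dependence + l.s.c."). Write `S(r₀; w) := ⨆ {cknC r z w : r > 0, Q_r(z) ⊆ Q_{r₀}(T, x₀)}` for the local scaled
cubic functional of a field `w` at `(T, x₀)`.

* `stub_nearThresholdFamilyBound` [XL; THE HEART — a TRANSFER of M to the super-threshold GLOBAL family]. Under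
  exactly the crux's hypotheses (same binder text): there are `r₀ ∈ (0, √T]` and `M < ⊤` such that for every
  `δ > 0` some viscosity `ν' ∈ (ν, ν + δ)` has `S(r₀; u') ≤ M` for EVERY Kato solution `u'` on `[0, T)` at `ν'`
  (these exist and are a.e. unique: restrictions of the hypothesised global Kato solutions, `kato_unique`). In words:
  the global smooth solutions just above the threshold do not concentrate more and more, in scaled `L³`, near
  `(T, x₀)` as `ν' ↓ ν` — at least along a sequence — for every `T` up to the threshold lifespan (the binder
  `IsKatoSolutionOn T ν u₀ u` is what restricts `T ≤ T_max(ν)`; the card's stronger "¬β at ALL times, also after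
  `T_max`" is deliberately NOT asked). For `T < T_max(ν)` it follows from `stub_viscosityContinuity` (the limit is
  bounded in `L³` on `[0, T]`); the content is `T = T_max(ν)`, the layer `(T_max − ε, T_max)`. WHY EASIER THAN M
  (transfer, not costume): every member is a GLOBAL, SMOOTH (for `t > 0`) Kato solution, so the quantitative
  regularity theory of smooth solutions with a priori critical bounds (energy equality, backward uniqueness on
  `[0, ∞)`, Barker–Prange localized smoothing arXiv:1812.09115, Tao's quantitative `L³` bounds arXiv:1908.04958) bites
  on each member, the family is real-analytic in ONE parameter, and a failure produces a blow-up sequence of GLOBAL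
  solutions whose rescaled limits are ETERNAL (ancient and forward-global) — strictly more structure than the ancient
  limits available at the threshold itself, where only `‖u(t)‖₃ → ∞` is known. Why it might fail: the survived bursts
  of the super-threshold solutions may OVERSHOOT the threshold solution in the layer `(T_max − ε(ν'), T_max)`
  (free global families carry arbitrarily concentrated bursts by grafting, Chemin–Gallagher–Paicu 2011; the averaged
  equation blows up at Type-II rate, Tao 2016), so uniformity could fail even if M holds. Sources:
  GallagherIftimiePlanchon2003 (Thm 3.1–3.2: the global set is open, the threshold is approached through global
  solutions), MatanoMerle2011 (threshold ⇒ Type I, model), CheminGallagherPaicu2011, Tao2016AveragedNS,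
  arXiv:1812.09115, arXiv:1908.04958, Seregin2006 / AlbrittonBarker2019 (scaled quantities).
* `stub_viscosityContinuity` [L; CONTINUOUS DEPENDENCE OF KATO SOLUTIONS ON THE VISCOSITY, locally uniformly below the
  lifespan]. If `u` is a Kato solution on `[0, T)` at `ν > 0` and `u_k` are Kato solutions on `[0, T)` at viscosities
  `ν_k > 0`, `ν_k → ν`, all from the same datum, then `sup_{t ∈ [0, T'']} ‖u_k(t) − u(t)‖₃ → 0` for every
  `T'' < T`. Why plausibly true (known-result chain, not in tree): `v_k(s, x) := ν_k⁻¹ u_k(s/ν_k, x)` are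
  unit-viscosity Kato solutions from `ν_k⁻¹ u₀ → ν⁻¹ u₀` in `L³` (`KatoViscosityScaling.lean`); finite-interval
  `L³`-stability of Kato solutions on `[0, S]`, `S < ν T` (the proof of GIP 2003 Thm 3.1 on a compact sub-interval
  of the lifespan; Kato 1984; uniqueness Furioli–Lemarié-Rieusset–Terraneo 2000 = `kato_unique`, proved in tree)
  plus uniform continuity of `v ∈ C([0, S]; L³)` to undo the time reparametrisation. Why it might fail: only
  through a mismatch of solution classes (duality-form mild vs Duhamel) — both are settled in tree for Kato's class.
  Sources: Kato1984, GallagherIftimiePlanchon2003 (Thm 3.1), LemarieRieusset2016, FurioliLemarieRieussetTerraneo2000.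
* `stub_scaledBoundOfLimit` [M; THE SCALED CUBIC BOUND IS CLOSED UNDER LOCALLY UNIFORM `L³` CONVERGENCE]. If
  `u_k → u` in `L³` uniformly on `[0, T'']` for every `T'' < T`, all fields measurable on the strip `(0,T) × ℝ³`,
  `0 < r₀`, `r₀² ≤ T` (so every sub-cylinder of `Q_{r₀}(T, x₀)` lies in the strip), and `S(r₀; u_k) ≤ M` for all
  `k`, then `S(r₀; u) ≤ M`. Why true: for a sub-cylinder `Q = (a, b) × B`, Minkowski in `L³(Q ∩ {t < T''})` gives
  `‖u‖ ≤ ‖u_k‖_{L³(Q)} + (T'' − a)^{1/3} sup_t ‖u_k(t) − u(t)‖₃ → (r² M)^{1/3}`, then `T'' ↑ T` by monotone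
  convergence (Tonelli needs the strip measurability). Pure measure theory, no NS content, but a genuine lemma
  (ENNReal `lintegral` on product sets, exhaustion of the time layer). Sources: folklore (Fatou/Minkowski);
  CaffarelliKohnNirenberg1982 §2 for the scaled quantities.

COMPOSITION (real, this file): `MarginalBlowupTypeI_of : Theses.AmplitudeIndex.MarginalBlowupTypeI` — the ONLY
theorem concluding the AmplitudeIndex crux, BY NAME, no hypotheses; it calls the three stubs by name: take
`r₀, M` and the frequency clause from the heart; `choose` viscosities `ν < ν_k < ν + 1/(k+1)` and (from the crux
hypothesis `∀ ν' > ν, HasGlobalKatoSolution ν' u₀`, restricted by `HasGlobalKatoSolution.exists_isKatoSolutionOn`)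
Kato solutions `u_k` on `[0, T)` at `ν_k`, each obeying `S(r₀; u_k) ≤ M`; `ν_k → ν` by squeezing;
`stub_viscosityContinuity` gives locally uniform `L³` convergence; `stub_scaledBoundOfLimit` gives `S(r₀; u) ≤ M < ⊤`.
`MarginalBlowupTypeI_of_MarginalTypeI` restates it for route MarginalTypeI's byte-identical decl (definitional).
`lean check`: rc 0; sorries = the 3 stubs, nothing else (audit quoted in `Lines/birth.md`).
-/

noncomputable section

open Set MeasureTheory Filter Topology

namespace Summit.NavierStokesRegularity.NavierStokesRegularity.Cruxes.MarginalBlowupTypeI.Birth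

set_option linter.unusedVariables false
set_option linter.dupNamespace false

/-- **stub 1 — `stub_nearThresholdFamilyBound` (XL; the heart: transfer of M to the super-threshold global
family).** Under the crux's hypotheses (critical viscosity `ν` of a Clay datum `u₀`; `u` a Kato solution on `[0,T)`
at `ν`, so `T ≤ T_max(ν)`; a point `x₀`): there are `r₀` with `0 < r₀`, `r₀² ≤ T`, and `M < ⊤` such that for every
`δ > 0` some `ν' ∈ (ν, ν + δ)` has: every Kato solution `u'` on `[0,T)` at `ν'` from `u₀` obeys
`⨆ {cknC r z u' : r > 0, Q_r(z) ⊆ Q_{r₀}(T,x₀)} ≤ M`. Sources: GallagherIftimiePlanchon2003, MatanoMerle2011,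
arXiv:1812.09115, arXiv:1908.04958; why it might fail: overshooting survived bursts (CheminGallagherPaicu2011,
Tao2016AveragedNS). -/
theorem stub_nearThresholdFamilyBound :
    ∀ ν : ℝ, 0 < ν → ∀ u₀ : EuclideanSpace ℝ (Fin 3) → EuclideanSpace ℝ (Fin 3), ContDiff ℝ (⊤ : ℕ∞) u₀ →
    Literature.Analysis.FluidPDE.NSWave0.IsDivFree u₀ → Literature.Analysis.FluidPDE.HasRapidSpatialDecay u₀ →
    (∀ ν' : ℝ, ν < ν' → Literature.Analysis.FluidPDE.HasGlobalKatoSolution ν' u₀) →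
    ¬ Literature.Analysis.FluidPDE.HasGlobalKatoSolution ν u₀ →
    ∀ (T : ℝ) (u : ℝ → EuclideanSpace ℝ (Fin 3) → EuclideanSpace ℝ (Fin 3)), 0 < T →
    Literature.Analysis.FluidPDE.IsKatoSolutionOn T ν u₀ u →
    ∀ x₀ : EuclideanSpace ℝ (Fin 3), ∃ r₀ : ℝ, 0 < r₀ ∧ r₀ ^ 2 ≤ T ∧ ∃ M : ENNReal, M < ⊤ ∧
      ∀ δ : ℝ, 0 < δ → ∃ ν' : ℝ, ν < ν' ∧ ν' < ν + δ ∧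
        ∀ u' : ℝ → EuclideanSpace ℝ (Fin 3) → EuclideanSpace ℝ (Fin 3),
          Literature.Analysis.FluidPDE.IsKatoSolutionOn T ν' u₀ u' →
          (⨆ (r : ℝ) (_ : 0 < r) (z : ℝ × EuclideanSpace ℝ (Fin 3))
            (_ : Literature.Analysis.FluidPDE.parabolicCylinder r z ⊆
              Literature.Analysis.FluidPDE.parabolicCylinder r₀ (T, x₀)),
            Literature.Analysis.FluidPDE.cknC r z u') ≤ M := by
  sorry

/-- **stub 2 — `stub_viscosityContinuity` (L; continuous dependence of Kato solutions on the viscosity, locally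
uniformly in time below the lifespan).** If `u` is a Kato solution on `[0,T)` at `ν > 0` from `u₀`, and `us k` are
Kato solutions on `[0,T)` at viscosities `νs k > 0` with `νs k → ν`, all from `u₀`, then for every `T'' < T`,
`⨆_{t ∈ [0,T'']} ‖us k t − u t‖_{L³} → 0` as `k → ∞`. Sources: Kato1984, GallagherIftimiePlanchon2003 (Thm 3.1,
finite-interval form), LemarieRieusset2016, `kato_unique` (in tree), `KatoViscosityScaling.lean`. -/
theorem stub_viscosityContinuity :
    ∀ ν : ℝ, 0 < ν → ∀ (u₀ : EuclideanSpace ℝ (Fin 3) → EuclideanSpace ℝ (Fin 3)) (T : ℝ)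
    (u : ℝ → EuclideanSpace ℝ (Fin 3) → EuclideanSpace ℝ (Fin 3)), 0 < T →
    Literature.Analysis.FluidPDE.IsKatoSolutionOn T ν u₀ u →
    ∀ (νs : ℕ → ℝ) (us : ℕ → ℝ → EuclideanSpace ℝ (Fin 3) → EuclideanSpace ℝ (Fin 3)),
    (∀ k, 0 < νs k) → Filter.Tendsto νs Filter.atTop (nhds ν) →
    (∀ k, Literature.Analysis.FluidPDE.IsKatoSolutionOn T (νs k) u₀ (us k)) →
    ∀ T'' : ℝ, T'' < T →
      Filter.Tendsto (fun k => ⨆ t ∈ Set.Icc (0 : ℝ) T'',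
        MeasureTheory.eLpNorm (us k t - u t) 3 MeasureTheory.volume) Filter.atTop (nhds 0) := by
  sorry

/-- **stub 3 — `stub_scaledBoundOfLimit` (M; the local scaled cubic bound is closed under locally uniform `L³`
convergence).** If `us k → u` in `L³` uniformly on `[0,T'']` for every `T'' < T`, all fields are measurable on the
strip `(0,T) × ℝ³`, `0 < r₀`, `r₀² ≤ T`, and `⨆ {cknC r z (us k) : r > 0, Q_r(z) ⊆ Q_{r₀}(T,x₀)} ≤ M` for every `k`,
then the same bound holds for `u`. Sources: folklore (Minkowski/Fatou, monotone convergence);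
CaffarelliKohnNirenberg1982 §2. -/
theorem stub_scaledBoundOfLimit :
    ∀ (T : ℝ) (u : ℝ → EuclideanSpace ℝ (Fin 3) → EuclideanSpace ℝ (Fin 3))
    (us : ℕ → ℝ → EuclideanSpace ℝ (Fin 3) → EuclideanSpace ℝ (Fin 3))
    (x₀ : EuclideanSpace ℝ (Fin 3)) (r₀ : ℝ) (M : ENNReal), 0 < r₀ → r₀ ^ 2 ≤ T →
    MeasureTheory.AEStronglyMeasurable (Function.uncurry u)
      (MeasureTheory.volume.restrict (Set.Ioo 0 T ×ˢ Set.univ)) →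
    (∀ k, MeasureTheory.AEStronglyMeasurable (Function.uncurry (us k))
      (MeasureTheory.volume.restrict (Set.Ioo 0 T ×ˢ Set.univ))) →
    (∀ T'' : ℝ, T'' < T →
      Filter.Tendsto (fun k => ⨆ t ∈ Set.Icc (0 : ℝ) T'',
        MeasureTheory.eLpNorm (us k t - u t) 3 MeasureTheory.volume) Filter.atTop (nhds 0)) →
    (∀ k, (⨆ (r : ℝ) (_ : 0 < r) (z : ℝ × EuclideanSpace ℝ (Fin 3))
            (_ : Literature.Analysis.FluidPDE.parabolicCylinder r z ⊆
              Literature.Analysis.FluidPDE.parabolicCylinder r₀ (T, x₀)),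
            Literature.Analysis.FluidPDE.cknC r z (us k)) ≤ M) →
    (⨆ (r : ℝ) (_ : 0 < r) (z : ℝ × EuclideanSpace ℝ (Fin 3))
      (_ : Literature.Analysis.FluidPDE.parabolicCylinder r z ⊆
        Literature.Analysis.FluidPDE.parabolicCylinder r₀ (T, x₀)),
      Literature.Analysis.FluidPDE.cknC r z u) ≤ M := by
  sorry

/-! ### The composition (real proof; no placeholder below this line) -/

/-- **The skeleton theorem = the composition** (concludes the crux `Theses.AmplitudeIndex.MarginalBlowupTypeI` BY
NAME, no hypotheses; placeholders only inside the three declared stubs, all three used by name). Heart (transfer to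
the super-threshold family, along a sequence `ν_k ↓ ν`) × continuous dependence in the viscosity × closedness of the
scaled bound under the resulting locally uniform `L³` convergence. -/
theorem MarginalBlowupTypeI_of : Theses.AmplitudeIndex.MarginalBlowupTypeI := by
  intro ν hν u₀ hsm hdiv hdec hglob hng T u hT hu x₀
  obtain ⟨r₀, hr₀, hr₀T, M, hM, hfreq⟩ :=
    stub_nearThresholdFamilyBound ν hν u₀ hsm hdiv hdec hglob hng T u hT hu x₀
  -- a sequence of super-threshold viscosities `ν < νs k < ν + 1/(k+1)` carrying the family bound
  have hδ : ∀ k : ℕ, (0 : ℝ) < 1 / ((k : ℝ) + 1) := fun k => by positivity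
  choose νs hgt hlt hbd using fun k : ℕ => hfreq (1 / ((k : ℝ) + 1)) (hδ k)
  -- Kato solutions on `[0,T)` at those viscosities exist: restrictions of the global ones
  choose us hus using fun k : ℕ => (hglob (νs k) (hgt k)).exists_isKatoSolutionOn T
  have hνpos : ∀ k, 0 < νs k := fun k => hν.trans (hgt k)
  have hνs : Filter.Tendsto νs Filter.atTop (nhds ν) := by
    have h0 : Filter.Tendsto (fun _ : ℕ => ν) Filter.atTop (nhds ν) := tendsto_const_nhds
    have h1 : Filter.Tendsto (fun k : ℕ => ν + 1 / ((k : ℝ) + 1)) Filter.atTop (nhds ν) := by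
      simpa using h0.add tendsto_one_div_add_atTop_nhds_zero_nat
    exact tendsto_of_tendsto_of_tendsto_of_le_of_le h0 h1 (fun k => (hgt k).le) (fun k => (hlt k).le)
  have hconv := stub_viscosityContinuity ν hν u₀ T u hT hu νs us hνpos hνs hus
  have hle := stub_scaledBoundOfLimit T u us x₀ r₀ M hr₀ hr₀T hu.aestronglyMeasurable
    (fun k => (hus k).aestronglyMeasurable) hconv (fun k => hbd k (us k) (hus k))
  exact ⟨r₀, hr₀, lt_of_le_of_lt hle hM⟩

/-- The same composition read as a proof of route MarginalTypeI's copy of the shared crux (the two decls have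
byte-identical bodies, so this is definitional). Not a second skeleton: a convenience for the shared close. -/
theorem MarginalBlowupTypeI_of_MarginalTypeI : Theses.MarginalTypeI.MarginalBlowupTypeI :=
  MarginalBlowupTypeI_of

end Summit.NavierStokesRegularity.NavierStokesRegularity.Cruxes.MarginalBlowupTypeI.Birth
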